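import Mathlib
import HarnessLib
import Summits.Ventures.LatticeQCDFlow.Scoring.IMHAcceptanceRecord
import Summits.Ventures.LatticeQCDFlow.Scoring.IMHAcceptanceRecordTilt
import Summits.Ventures.LatticeQCDFlow.Scoring.IMHAcceptanceRecordSojourn
import Summits.Ventures.LatticeQCDFlow.Exactness.ApproxTrivializingSampler

/-!
# The acceptance record of the exact flow-MCMC chain, V: exits from a sojourn — the jump chain

HONEST FRAMING: exact (Metropolis-corrected) sampling algorithms for lattice gauge theory;
figures of merit are autocorrelation/cost numbers at stated couplings and volumes; no
continuum-physics claim.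

Venture `LatticeQCDFlow` (cell pub-lqcd), topic `Scoring`; flow / samplers seat (GEN-40).  NEW WORK
of the cell, not a published result; no definition is introduced; nothing is cited as a fact.
Printed counterparts NAMED ONLY: the "jump chain" of the accepted states of a Metropolis–Hastings
path with their geometric holding times (Malefaki–Iliopoulos, Statist. Probab. Lett. 78 (2008)
§3.1; Douc–Robert, Ann. Statist. 39 (2011) Lemma 1; Vihola–Helske–Franks, Scand. J. Statist. 47
(2020)).  Built on I (`IMHAcceptanceRecord.lean`: THE RECORD LAW `integral_acceptFlag_mul`),
III (`…Tilt`), IV (`…Sojourn`: `rejectRun_tower`) and `ChainTimeAverage.lean` (`chain_tower`,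
`chain_marginal` over `Kernel.trajMeasure`).  Notation of I–IV: model `q`, weight `w > 0`, `a(x, y)
= imhAccept w x y = min(1, w y / w x)`, `α = (imhAcceptMass q w ·).toReal`, `K = indepMH q w`,
`A = acceptFlag`, `Z_n = (X_n, A_n)` the record chain, `P̂_{μ̂₀}` its path law from ANY initial
record law, `P̂ = imhRecordPath q w π` the stationary one (`π K = π`), `π̂ = imhRecord q w ∘ₘ π`.
The ACCEPT PART of a step, written out: `(J g)(x) := ∫ a(x, y) g(y) dq(y) = K g − (1 − α) g` (§0).
* §2 **`exitRun_tower`** (any start; bounded measurable history functional `F`, observable `g`):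
  `E[F(Z_{≤a}) Π_{j<k}(1 − A_{a+1+j}) · A_{a+1+k} g(X_{a+1+k})] = E[F(Z_{≤a}) (1 − α(X_a))^k
  (J g)(X_a)]` — GIVEN THE PAST, the length of the rejection run after `a` and the state the chain
  jumps to at its end are CONDITIONALLY INDEPENDENT, with laws `(1 − α(X_a))^k α(X_a)` and
  `a(X_a, y) q(dy) / α(X_a)` (the jump-chain kernel).  §3 in equilibrium: **`acceptedExit_prob_eq`**
  `P̂(Z_a ∈ S × {acc}, k rejections after a, Z_{a+1+k} ∈ S' × {acc}) = ∫_S α (1 − α)^k (J 1_{S'})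
  dπ`; summed over `k` (**`hasSum_acceptedExit_prob`**), THE LAW OF TWO CONSECUTIVE ACCEPTED STATES
  `Γ(S, S') = ∫_S ∫_{S'} a(x, y) q(dy) π(dx)` (density `min(w x, w y)` against `q ⊗ q` when
  `π = w q`; first marginal `∫_S α dπ = P̂(Z_a ∈ S × {acc})`, the tilt of III).
* §4 `flowSampler_jump_law`: the instance for the exact flow sampler on `SU(n)^E` under the
  hypotheses of `Exactness.flowSampler_exact_doeblin` (uniform Lüscher defect `δ`, every volume).
NOT CLAIMED: any number of ours; not typed here: the acceptance-indexed (random-epoch, strong-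
Markov) form of §2–§3 (these are fixed-time tower forms), the symmetry of `Γ`, the stationarity of
the tilt under it, the Rao–Blackwellised multiplicity moments given the past (`1/α`, `(1 − α)/α²`);
no CLT, no variance ranking of estimators, no cost statement, nothing deciding between samplers.
-/

noncomputable section
namespace Summit.Ventures.LatticeQCDFlow.Scoring
open MeasureTheory ProbabilityTheory Filter Finset Preorder Summit.Ventures.LatticeQCDFlow.Exactness
open scoped ENNReal Topology

variable {Ω : Type*} [MeasurableSpace Ω]

omit [MeasurableSpace Ω] in
/-- `1_{S × {accept}}(z) = A(z) · 1_S(z.1)`. -/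
theorem indicator_prod_true (S : Set Ω) (z : Ω × Bool) :
    (S ×ˢ ({true} : Set Bool)).indicator (1 : Ω × Bool → ℝ) z
      = acceptFlag z * S.indicator 1 z.1 := by
  obtain ⟨y, b⟩ := z
  cases b <;> by_cases hy : y ∈ S <;> simp [acceptFlag, hy, Set.mem_prod]

/-- `1{f ∈ T, g ∈ T', Q} = 1_T(f ·) · 1_Q · 1_{T'}(g ·)`. -/
theorem ExitRun.indicator_and₃ {X Y : Type*} (T T' : Set Y) (f g : X → Y) (Q : X → Prop)
    (x : X) :
    {y | f y ∈ T ∧ (g y ∈ T' ∧ Q y)}.indicator (1 : X → ℝ) x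
      = T.indicator 1 (f x) * {y | Q y}.indicator 1 x * T'.indicator 1 (g x) := by
  by_cases h1 : f x ∈ T <;> by_cases h2 : g x ∈ T' <;> by_cases h3 : Q x <;> simp [h1, h2, h3]

variable {q : Measure Ω} [IsProbabilityMeasure q] {w : Ω → ℝ} {π : Measure Ω}

/-! ### §0–§1 The accept part `(J g)(x) = ∫ a(x, y) g(y) dq(y)` of one (record) step -/

/-- **`J g = K g − (1 − α) g`**. -/
theorem integral_imhAccept_mul_eq (hw : Measurable w) (hw0 : ∀ x, 0 < w x) {g : Ω → ℝ}
    (hg : Measurable g) {C : ℝ} (hC : ∀ x, |g x| ≤ C) (x : Ω) :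
    ∫ y, imhAccept w x y * g y ∂q
      = kop (indepMH q w) g x - (1 - (imhAcceptMass q w x).toReal) * g x := by
  have ham := measurable_imhAccept_right hw x
  have hab : ∀ y, |imhAccept w x y| ≤ 1 := fun y => by
    rw [abs_of_nonneg (imhAccept_nonneg hw0 x y)]; exact imhAccept_le_one w x y
  have hIa : Integrable (imhAccept w x) q := integrable_of_bounded q ham hab
  have hIag : Integrable (fun y => imhAccept w x y * g y) q :=
    integrable_of_bounded q (ham.mul hg) (C := 1 * C) fun y => by
      rw [abs_mul]; exact mul_le_mul (hab y) (hC y) (abs_nonneg _) zero_le_one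
  have hIr : Integrable (fun y => (1 - imhAccept w x y) * g x) q :=
    ((integrable_const (1 : ℝ)).sub hIa).mul_const (g x)
  rw [kop_indepMH hw hw0 hg hC x, integral_add hIag hIr, integral_mul_const,
    integral_sub (integrable_const _) hIa, integral_const, probReal_univ, one_smul,
    ← toReal_imhAcceptMass hw hw0]
  ring

/-- `J g` is measurable, and `|J g| ≤ 2C` (`|K g| ≤ C`, `|(1 − α) g| ≤ C`). -/
theorem measurable_integral_imhAccept_mul (hw : Measurable w) (hw0 : ∀ x, 0 < w x) {g : Ω → ℝ}
    (hg : Measurable g) {C : ℝ} (hC : ∀ x, |g x| ≤ C) :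
    Measurable fun x => ∫ y, imhAccept w x y * g y ∂q := by
  haveI : Fact (Measurable w) := ⟨hw⟩
  rw [show (fun x => ∫ y, imhAccept w x y * g y ∂q)
      = fun x => kop (indepMH q w) g x - (1 - (imhAcceptMass q w x).toReal) * g x from
    funext (integral_imhAccept_mul_eq hw hw0 hg hC)]
  exact (measurable_kop _ hg).sub
    ((measurable_const.sub (measurable_toReal_imhAcceptMass hw)).mul hg)

/-- `|J g| ≤ 2C`. -/
theorem abs_integral_imhAccept_mul_le (hw : Measurable w) (hw0 : ∀ x, 0 < w x) {g : Ω → ℝ}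
    (hg : Measurable g) {C : ℝ} (hC : ∀ x, |g x| ≤ C) (x : Ω) :
    |∫ y, imhAccept w x y * g y ∂q| ≤ 2 * C := by
  haveI : Fact (Measurable w) := ⟨hw⟩
  rw [integral_imhAccept_mul_eq hw hw0 hg hC x]
  have h1 := abs_kop_le (indepMH q w) hC x
  have h2 : |(1 - (imhAcceptMass q w x).toReal) * g x| ≤ C := by
    rw [abs_mul, abs_of_nonneg (sub_nonneg.2 (toReal_imhAcceptMass_le_one x))]
    exact (mul_le_of_le_one_left (abs_nonneg _) (sub_le_self _ ENNReal.toReal_nonneg)).trans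
      (hC x)
  exact (abs_sub _ _).trans (by linarith)

omit [IsProbabilityMeasure q] in
/-- `(J 1_S)(x) = ∫_S a(x, y) dq(y)`. -/
theorem integral_imhAccept_mul_indicator (x : Ω) {S : Set Ω} (hS : MeasurableSet S) :
    ∫ y, imhAccept w x y * S.indicator 1 y ∂q = ∫ y in S, imhAccept w x y ∂q := by
  rw [← integral_indicator hS]
  exact integral_congr_ae (ae_of_all _ fun y => by by_cases hy : y ∈ S <;> simp [hy])

omit [MeasurableSpace Ω] in
/-- `|1_S| ≤ 1`. -/
theorem ExitRun.abs_indicator_one_le (S : Set Ω) (y : Ω) : |S.indicator (1 : Ω → ℝ) y| ≤ 1 := by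
  by_cases hy : y ∈ S <;> simp [hy]
/-- `K̂[A · (g ∘ fst)] = (J g) ∘ fst`: the ACCEPT part of one record step (IV's
`kop_imhRecord_rejectFlag_mul` is the reject part). -/
theorem kop_imhRecord_acceptFlag_mul (hw : Measurable w) (hw0 : ∀ x, 0 < w x) {g : Ω → ℝ}
    (hg : Measurable g) {C : ℝ} (hC : ∀ x, |g x| ≤ C) :
    kop (Kernel.prodMkRight Bool (imhRecord q w)) (fun z => acceptFlag z * g z.1)
      = fun z => ∫ y, imhAccept w z.1 y * g y ∂q := by
  have hGm : Measurable fun z : Ω × Bool => acceptFlag z * g z.1 :=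
    measurable_acceptFlag.mul (hg.comp measurable_fst)
  have hGb : ∀ z : Ω × Bool, |acceptFlag z * g z.1| ≤ 1 * C := fun z => by
    rw [abs_mul]; exact mul_le_mul (abs_acceptFlag_le z) (hC z.1) (abs_nonneg _) zero_le_one
  funext z
  unfold kop
  rw [Kernel.prodMkRight_apply, integral_imhRecord hw hw0 hGm hGb z.1]
  exact integral_congr_ae (ae_of_all _ fun y => by simp [acceptFlag])

/-! ### §2 The exit tower (any start) -/

section Path
variable [Fact (Measurable w)]

/-- **THE EXIT TOWER** (any initial record law `μ̂₀`; bounded measurable history functional `F`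
and observable `g`): `E[F(Z_{≤a}) Π_{j<k}(1 − A_{a+1+j}) A_{a+1+k} g(X_{a+1+k})] = E[F(Z_{≤a})
(1 − α(X_a))^k (J g)(X_a)]` — given the past, "`k` rejections, then a jump INTO `dy`" has
conditional law EXACTLY `(1 − α(X_a))^k a(X_a, y) q(dy)`: run length ⫫ exit state. -/
theorem exitRun_tower (hw0 : ∀ x, 0 < w x) (μ₀ : Measure (Ω × Bool)) [IsProbabilityMeasure μ₀]
    {g : Ω → ℝ} (hg : Measurable g) {Cg : ℝ} (hCg : ∀ x, |g x| ≤ Cg) :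
    let P := Kernel.trajMeasure (X := fun _ : ℕ => Ω × Bool) μ₀
      (fun t : ℕ => (Kernel.prodMkRight Bool (imhRecord q w)).comap
        (fun y : (i : ↥(Finset.Iic t)) → Ω × Bool => y ⟨t, Finset.mem_Iic.2 le_rfl⟩)
        (measurable_pi_apply _))
    ∀ (k a : ℕ) {F : ((i : ↥(Finset.Iic a)) → Ω × Bool) → ℝ}, Measurable F → ∀ {CF : ℝ},
      (∀ h, |F h| ≤ CF) →
      ∫ x, F (frestrictLe a x) * (∏ j ∈ range k, (1 - acceptFlag (x (a + 1 + j)))) *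
          (acceptFlag (x (a + 1 + k)) * g (x (a + 1 + k)).1) ∂P
        = ∫ x, F (frestrictLe a x) * ((1 - (imhAcceptMass q w (x a).1).toReal) ^ k *
            ∫ y, imhAccept w (x a).1 y * g y ∂q) ∂P := by
  intro P k
  have hw : Measurable w := Fact.out
  induction k with
  | zero =>
    intro a F hF CF hCF
    have key := chain_tower (Kernel.prodMkRight Bool (imhRecord q w)) μ₀ a hF hCF
      (g := fun z : Ω × Bool => acceptFlag z * g z.1)
      (measurable_acceptFlag.mul (hg.comp measurable_fst)) (Cg := 1 * Cg) fun z => by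
        rw [abs_mul]; exact mul_le_mul (abs_acceptFlag_le z) (hCg z.1) (abs_nonneg _) zero_le_one
    rw [kop_imhRecord_acceptFlag_mul hw hw0 hg hCg] at key; beta_reduce at key
    simpa only [prod_range_zero, mul_one, pow_zero, one_mul, add_zero] using key
  | succ k ih =>
    intro a F hF CF hCF
    have hφm : Measurable fun x : Ω => (1 - (imhAcceptMass q w x).toReal) ^ k *
        ∫ y, imhAccept w x y * g y ∂q :=
      ((measurable_const.sub (measurable_toReal_imhAcceptMass hw)).pow_const k).mul
        (measurable_integral_imhAccept_mul hw hw0 hg hCg)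
    have hφb : ∀ x : Ω, |(1 - (imhAcceptMass q w x).toReal) ^ k * ∫ y, imhAccept w x y * g y ∂q|
        ≤ 1 * (2 * Cg) := fun x => by
      rw [abs_mul]
      exact mul_le_mul (abs_pow_one_sub_toReal_imhAcceptMass_le x k)
        (abs_integral_imhAccept_mul_le hw hw0 hg hCg x) (abs_nonneg _) zero_le_one
    have ih' := ih (a + 1) -- the first rejection moved into the history
      (F := fun h : (i : ↥(Finset.Iic (a + 1))) → Ω × Bool =>
        F (frestrictLe₂ (π := fun _ : ℕ => Ω × Bool) (Nat.le_succ a) h) *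
          (1 - acceptFlag (h ⟨a + 1, Finset.mem_Iic.2 le_rfl⟩)))
      ((hF.comp (measurable_frestrictLe₂ (X := fun _ : ℕ => Ω × Bool) (Nat.le_succ a))).mul
        (measurable_const.sub (measurable_acceptFlag.comp (measurable_pi_apply _))))
      (CF := |CF| * 1) fun h => by
        rw [abs_mul]
        exact mul_le_mul ((hCF _).trans (le_abs_self _)) (abs_one_sub_acceptFlag_le _)
          (abs_nonneg _) (abs_nonneg _)
    have key := chain_tower (Kernel.prodMkRight Bool (imhRecord q w)) μ₀ a hF hCF
      (g := fun z : Ω × Bool => (1 - acceptFlag z) *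
        ((1 - (imhAcceptMass q w z.1).toReal) ^ k * ∫ y, imhAccept w z.1 y * g y ∂q))
      ((measurable_const.sub measurable_acceptFlag).mul (hφm.comp measurable_fst))
      (Cg := 1 * (1 * (2 * Cg))) fun z => by
        rw [abs_mul]
        exact mul_le_mul (abs_one_sub_acceptFlag_le z) (hφb z.1) (abs_nonneg _) zero_le_one
    rw [kop_imhRecord_rejectFlag_mul hw hw0 hφm hφb] at key; beta_reduce at key
    simp only [show ∀ j : ℕ, a + 1 + 1 + j = a + 1 + (j + 1) from fun j => by omega] at ih'
    calc _ = ∫ x : ℕ → Ω × Bool, F (frestrictLe₂ (π := fun _ : ℕ => Ω × Bool) (Nat.le_succ a)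
                (frestrictLe (a + 1) x)) *
              (1 - acceptFlag (frestrictLe (a + 1) x ⟨a + 1, Finset.mem_Iic.2 le_rfl⟩)) *
            (∏ j ∈ range k, (1 - acceptFlag (x (a + 1 + (j + 1))))) *
            (acceptFlag (x (a + 1 + (k + 1))) * g (x (a + 1 + (k + 1))).1) ∂P := by
          refine integral_congr_ae (ae_of_all _ fun x => ?_)
          dsimp only
          show _ = F (frestrictLe a x) * (1 - acceptFlag (x (a + 1))) * _ * _
          rw [prod_range_succ', Nat.add_zero]
          ring
      _ = _ := ih'
      _ = ∫ x : ℕ → Ω × Bool, F (frestrictLe a x) * ((1 - acceptFlag (x (a + 1))) *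
            ((1 - (imhAcceptMass q w (x (a + 1)).1).toReal) ^ k *
              ∫ y, imhAccept w (x (a + 1)).1 y * g y ∂q)) ∂P :=
          integral_congr_ae (ae_of_all _ fun x => mul_assoc _ _ _)
      _ = _ := key
      _ = _ := integral_congr_ae (ae_of_all _ fun x => by ring)

/-! ### §3 Exits in equilibrium: the law of two consecutive accepted states -/

variable [IsProbabilityMeasure π]

/-- **Exit moments in equilibrium**: for bounded measurable `Φ` on `Ω × Bool` and `g` on `Ω`,
`E_P̂[Φ(Z_a) Π_{j<k}(1 − A_{a+1+j}) A_{a+1+k} g(X_{a+1+k})] = ∫ Φ · (((1 − α)^k J g) ∘ fst) dπ̂`. -/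
theorem integral_mul_exitRun (hw0 : ∀ x, 0 < w x) (hinv : Kernel.Invariant (indepMH q w) π)
    {Φ : Ω × Bool → ℝ} (hΦ : Measurable Φ) {C : ℝ} (hC : ∀ z, |Φ z| ≤ C) {g : Ω → ℝ}
    (hg : Measurable g) {Cg : ℝ} (hCg : ∀ x, |g x| ≤ Cg) (a k : ℕ) :
    ∫ x, Φ (x a) * (∏ j ∈ range k, (1 - acceptFlag (x (a + 1 + j)))) *
        (acceptFlag (x (a + 1 + k)) * g (x (a + 1 + k)).1) ∂(imhRecordPath q w π)
      = ∫ z, Φ z * ((1 - (imhAcceptMass q w z.1).toReal) ^ k *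
          ∫ y, imhAccept w z.1 y * g y ∂q) ∂(imhRecord q w ∘ₘ π) := by
  have hw : Measurable w := Fact.out
  have h := exitRun_tower (q := q) hw0 (imhRecord q w ∘ₘ π) hg hCg k a
    (F := fun h : (i : ↥(Finset.Iic a)) → Ω × Bool => Φ (h ⟨a, Finset.mem_Iic.2 le_rfl⟩))
    (hΦ.comp (measurable_pi_apply _)) fun h => hC _
  simp only [frestrictLe_apply] at h
  rw [imhRecordPath, h]
  exact chain_marginal (imhRecord_invariant hw hinv) a
    (f := fun z : Ω × Bool => Φ z * ((1 - (imhAcceptMass q w z.1).toReal) ^ k *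
      ∫ y, imhAccept w z.1 y * g y ∂q))
    (hΦ.mul ((((measurable_const.sub (measurable_toReal_imhAcceptMass hw)).pow_const k).mul
      (measurable_integral_imhAccept_mul hw hw0 hg hCg)).comp measurable_fst))
    (C := C * (1 * (2 * Cg))) fun z => by
      rw [abs_mul, abs_mul]
      exact mul_le_mul (hC z) (mul_le_mul (abs_pow_one_sub_toReal_imhAcceptMass_le _ k)
        (abs_integral_imhAccept_mul_le hw hw0 hg hCg _) (abs_nonneg _) zero_le_one)
        (mul_nonneg (abs_nonneg _) (abs_nonneg _)) ((abs_nonneg _).trans (hC z))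

/-- **EXITS IN EQUILIBRIUM**: `P̂(Z_a ∈ S × {accept}, k rejections after a, Z_{a+1+k} ∈ S' ×
{accept}) = ∫_S α (1 − α)^k (J 1_{S'}) dπ`, `(J 1_{S'})(x) = ∫_{S'} a(x, y) dq(y)` (§0). -/
theorem acceptedExit_prob_eq (hw0 : ∀ x, 0 < w x) (hinv : Kernel.Invariant (indepMH q w) π)
    {S S' : Set Ω} (hS : MeasurableSet S) (hS' : MeasurableSet S') (a k : ℕ) :
    (imhRecordPath q w π).real {x | x a ∈ S ×ˢ ({true} : Set Bool) ∧
        (x (a + 1 + k) ∈ S' ×ˢ ({true} : Set Bool) ∧ ∀ j < k, (x (a + 1 + j)).2 = false)}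
      = ∫ x in S, (imhAcceptMass q w x).toReal * (1 - (imhAcceptMass q w x).toReal) ^ k *
          ∫ y, imhAccept w x y * S'.indicator 1 y ∂q ∂π := by
  have hw : Measurable w := Fact.out
  have hE : MeasurableSet {x : ℕ → Ω × Bool | x a ∈ S ×ˢ ({true} : Set Bool) ∧
      (x (a + 1 + k) ∈ S' ×ˢ ({true} : Set Bool) ∧ ∀ j < k, (x (a + 1 + j)).2 = false)} :=
    measurableSet_setOf.2 ((measurableSet_setOf.1
      (measurable_pi_apply a (hS.prod (measurableSet_singleton true)))).and
      ((measurableSet_setOf.1 (measurable_pi_apply (a + 1 + k)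
        (hS'.prod (measurableSet_singleton true)))).and (measurable_rejectRun a k)))
  have hi1 := ExitRun.abs_indicator_one_le (Ω := Ω)
  have hJm := measurable_integral_imhAccept_mul (q := q) hw hw0 (measurable_one.indicator hS')
    (hi1 S')
  have hJb := abs_integral_imhAccept_mul_le (q := q) hw hw0 (measurable_one.indicator hS') (hi1 S')
  rw [← integral_indicator_one hE]
  calc _ = ∫ x, acceptFlag (x a) * S.indicator 1 (x a).1 *
          (∏ j ∈ range k, (1 - acceptFlag (x (a + 1 + j)))) *
          (acceptFlag (x (a + 1 + k)) * S'.indicator 1 (x (a + 1 + k)).1)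
          ∂(imhRecordPath q w π) := by
        refine integral_congr_ae (ae_of_all _ fun x => ?_)
        dsimp only
        rw [prod_one_sub_acceptFlag, ← indicator_prod_true S (x a),
          ← indicator_prod_true S' (x (a + 1 + k))]
        exact ExitRun.indicator_and₃ _ _ (fun y : ℕ → Ω × Bool => y a)
          (fun y : ℕ → Ω × Bool => y (a + 1 + k)) _ x
    _ = _ := integral_mul_exitRun hw0 hinv (Φ := fun z => acceptFlag z * S.indicator 1 z.1)
          (measurable_acceptFlag.mul ((measurable_one.indicator hS).comp measurable_fst))
          (C := 1 * 1) (fun z => by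
            rw [abs_mul]
            exact mul_le_mul (abs_acceptFlag_le z) (hi1 S z.1) (abs_nonneg _) zero_le_one)
          (measurable_one.indicator hS') (hi1 S') a k
    _ = ∫ z, acceptFlag z * (S.indicator 1 z.1 * ((1 - (imhAcceptMass q w z.1).toReal) ^ k *
          ∫ y, imhAccept w z.1 y * S'.indicator 1 y ∂q)) ∂(imhRecord q w ∘ₘ π) :=
        integral_congr_ae (ae_of_all _ fun z => mul_assoc _ _ _)
    _ = _ := by
        rw [integral_acceptFlag_mul hw hw0 hinv (H := fun x => S.indicator 1 x *
            ((1 - (imhAcceptMass q w x).toReal) ^ k * ∫ y, imhAccept w x y * S'.indicator 1 y ∂q))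
          ((measurable_one.indicator hS).mul
            (((measurable_const.sub (measurable_toReal_imhAcceptMass hw)).pow_const k).mul hJm))
          (C := 1 * (1 * (2 * 1))) fun x => by
            rw [abs_mul, abs_mul]
            exact mul_le_mul (hi1 S x) (mul_le_mul (abs_pow_one_sub_toReal_imhAcceptMass_le x k)
              (hJb x) (abs_nonneg _) zero_le_one) (mul_nonneg (abs_nonneg _) (abs_nonneg _))
              zero_le_one,
          ← integral_indicator hS]
        exact integral_congr_ae (ae_of_all _ fun x => by
          by_cases hx : x ∈ S <;> simp [hx, mul_assoc])

omit [IsProbabilityMeasure π] in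
/-- Pointwise `Σ_k α (1 − α)^k c = c` (`α > 0`). -/
theorem hasSum_acceptMass_mul_geom (hw0 : ∀ x, 0 < w x) (x : Ω) (c : ℝ) :
    HasSum (fun k => (imhAcceptMass q w x).toReal * (1 - (imhAcceptMass q w x).toReal) ^ k * c)
      c := by
  have hw : Measurable w := Fact.out
  have hα0 := toReal_imhAcceptMass_pos (q := q) hw hw0 x
  have h := ((hasSum_geometric_of_lt_one (sub_nonneg.2 (toReal_imhAcceptMass_le_one (q := q)
    (w := w) x)) (sub_lt_self 1 hα0)).mul_left (imhAcceptMass q w x).toReal).mul_right c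
  rwa [sub_sub_cancel, mul_inv_cancel₀ hα0.ne', one_mul] at h

omit [IsProbabilityMeasure π] in
/-- `Σ_k ∫ α (1 − α)^k u dμ = ∫ u dμ` for bounded measurable `u` (dominated convergence). -/
theorem hasSum_integral_acceptMass_mul_geom (hw0 : ∀ x, 0 < w x) (μ : Measure Ω)
    [IsFiniteMeasure μ] {u : Ω → ℝ} (hu : Measurable u) {B : ℝ} (hB : ∀ x, |u x| ≤ B) :
    HasSum (fun k => ∫ x, (imhAcceptMass q w x).toReal * (1 - (imhAcceptMass q w x).toReal) ^ k *
      u x ∂μ) (∫ x, u x ∂μ) := by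
  have hw : Measurable w := Fact.out
  have hαm := measurable_toReal_imhAcceptMass (q := q) hw
  have hp : ∀ (x : Ω) (k : ℕ), 0 ≤ (imhAcceptMass q w x).toReal *
      (1 - (imhAcceptMass q w x).toReal) ^ k := fun x k =>
    mul_nonneg ENNReal.toReal_nonneg (pow_nonneg (sub_nonneg.2 (toReal_imhAcceptMass_le_one x)) _)
  refine hasSum_integral_of_dominated_convergence
    (fun k x => (imhAcceptMass q w x).toReal * (1 - (imhAcceptMass q w x).toReal) ^ k * B)
    (fun k => ((hαm.mul ((measurable_const.sub hαm).pow_const k)).mul hu).aestronglyMeasurable)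
    (fun k => ae_of_all _ fun x => ?_)
    (ae_of_all _ fun x => (hasSum_acceptMass_mul_geom (q := q) hw0 x B).summable)
    ((integrable_const B).congr (ae_of_all _ fun x =>
      ((hasSum_acceptMass_mul_geom (q := q) hw0 x B).tsum_eq).symm))
    (ae_of_all _ fun x => hasSum_acceptMass_mul_geom hw0 x (u x))
  rw [Real.norm_eq_abs, abs_mul, abs_of_nonneg (hp x k)]
  exact mul_le_mul_of_nonneg_left (hB x) (hp x k)

/-- **THE LAW OF TWO CONSECUTIVE ACCEPTED STATES.**  For measurable `S, S'` and every time `a`: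
`Σ_k P̂(Z_a ∈ S × {accept}, k rejections after a, Z_{a+1+k} ∈ S' × {accept}) = ∫_S ∫_{S'} a(x, y)
q(dy) π(dx)` — the accepted state at `a` and the NEXT accepted state have the joint law `a(x, y)
π(dx) q(dy)` (`= min(w x, w y) q(dx) q(dy)` for `π = w q`; jump kernel `a(x, y) q(dy) / α(x)`). -/
theorem hasSum_acceptedExit_prob (hw0 : ∀ x, 0 < w x) (hinv : Kernel.Invariant (indepMH q w) π)
    {S S' : Set Ω} (hS : MeasurableSet S) (hS' : MeasurableSet S') (a : ℕ) :
    HasSum (fun k => (imhRecordPath q w π).real {x | x a ∈ S ×ˢ ({true} : Set Bool) ∧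
        (x (a + 1 + k) ∈ S' ×ˢ ({true} : Set Bool) ∧ ∀ j < k, (x (a + 1 + j)).2 = false)})
      (∫ x in S, ∫ y in S', imhAccept w x y ∂q ∂π) := by
  have hw : Measurable w := Fact.out
  have hi1 := ExitRun.abs_indicator_one_le (Ω := Ω) S'
  simp_rw [acceptedExit_prob_eq hw0 hinv hS hS' a, ← integral_imhAccept_mul_indicator _ hS']
  exact hasSum_integral_acceptMass_mul_geom hw0 (π.restrict S)
    (measurable_integral_imhAccept_mul hw hw0 (measurable_one.indicator hS') hi1)
    (abs_integral_imhAccept_mul_le hw hw0 (measurable_one.indicator hS') hi1)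

end Path

/-! ### §4 The lattice instance -/

section Lattice

open Literature.MathematicalPhysics.QuantumFieldTheory
open Literature.MathematicalPhysics.QuantumFieldTheory.Luscher2010
open Summit.Ventures.LatticeQCDFlow.TrivializingMaps
open scoped Matrix Matrix.Norms.Frobenius ContDiff

variable {d L n : ℕ} [NeZero L]

/-- **THE JUMP CHAIN OF AN EXACT FLOW SAMPLER ON `SU(n)^E` — every volume** (hypotheses of
`flowSampler_exact_doeblin`: smooth action, approximately trivializing flow with uniform Lüscher
defect `δ`, model `q = (Φ 1)_* D[V]`, `π` = Boltzmann): a measurable weight `w` with `w · q = π`,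
`π K = π`, `α ≥ e^{−2δ}`, and, in equilibrium, for measurable `T, T'` and every time `a`:
`Σ_k P̂(Z_a ∈ T × {acc}, k rejections after a, Z_{a+1+k} ∈ T' × {acc}) = ∫_T ∫_{T'} a dq dπ`. -/
theorem flowSampler_jump_law (B : SuBasis n)
    {S : AmbConfig d L n → ℝ} (hS : ContDiff ℝ ∞ S) {F : ℝ → AmbConfig d L n → ℝ}
    (hF : ContDiff ℝ ∞ fun p : ℝ × AmbConfig d L n => F p.1 p.2)
    {Φ} (hΦ : IsFlowMap (fun t W => -linkGrad B (F t) W) Φ) {c : ℝ → ℝ} {δ : ℝ}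
    (hδ : ∀ t ∈ Set.Icc (0 : ℝ) 1, ∀ U : GaugeConfig d L (Matrix.specialUnitaryGroup (Fin n) ℂ),
      |luscherL B S t (F t) (WilsonFlow.coeConfig U) - S (WilsonFlow.coeConfig U) - c t| ≤ δ)
    (q : Measure (GaugeConfig d L (Matrix.specialUnitaryGroup (Fin n) ℂ))) [IsProbabilityMeasure q]
    (hq : q = Measure.map (Φ 1) (trivialMeasure (Matrix.specialUnitaryGroup (Fin n) ℂ) d L))
    {π : Measure (GaugeConfig d L (Matrix.specialUnitaryGroup (Fin n) ℂ))} [IsProbabilityMeasure π]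
    (hπB : π = boltzmannMeasure fun U => S (WilsonFlow.coeConfig U)) :
    ∃ w : GaugeConfig d L (Matrix.specialUnitaryGroup (Fin n) ℂ) → ℝ, Measurable w ∧
      (q.withDensity fun U => ENNReal.ofReal (w U)) = π ∧ Kernel.Invariant (indepMH q w) π ∧
      (∀ U, Real.exp (-(2 * δ)) ≤ (imhAcceptMass q w U).toReal) ∧
      ∀ [Fact (Measurable w)] (T T' : Set (GaugeConfig d L (Matrix.specialUnitaryGroup (Fin n) ℂ))),
        MeasurableSet T → MeasurableSet T' → ∀ a : ℕ,
        HasSum (fun k => (imhRecordPath q w π).real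
            {x | x a ∈ T ×ˢ ({true} : Set Bool) ∧ (x (a + 1 + k) ∈ T' ×ˢ ({true} : Set Bool) ∧
              ∀ j < k, (x (a + 1 + j)).2 = false)})
          (∫ U in T, ∫ V in T', imhAccept w U V ∂q ∂π) := by
  subst hπB
  obtain ⟨w, hw, hlo, -, hπ, hinv, hacc, -⟩ := flowSampler_exact_doeblin B hS hF hΦ hδ q hq
  have hw0 : ∀ U, 0 < w U := fun U => (Real.exp_pos _).trans_le (hlo U)
  exact ⟨w, hw, hπ, hinv, fun U => (ENNReal.ofReal_le_iff_le_toReal (ne_top_of_le_ne_top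
    ENNReal.one_ne_top (imhAcceptMass_le_one q w U))).1 (hacc U),
    fun T T' hT hT' a => hasSum_acceptedExit_prob hw0 hinv hT hT' a⟩

end Lattice

end Summit.Ventures.LatticeQCDFlow.Scoring
end
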